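import Literature.Algebra.Lie.RibetLemmaSimpleQuotient
import Literature.Algebra.Lie.SpecialLinearAutomorphismsHolds
import Literature.AlgebraicGeometry.HodgeTheory.GoursatKolchinRibetLieAlgebra
import HarnessLib

/-!
# Goursat–Kolchin–Ribet at the Lie-algebra level: a Lie algebra of tuples of traceless matrices projecting ONTO
# every `𝔰𝔩(mⱼ)` contains each factor `𝔰𝔩(m_{i₀}) ⊕ 0`, or two factors are TWISTED onto each other
# (Ribet 1976 pp. 790–791; Katz 1990 Prop. 1.8.2, Lie half; Jacobson 1962 IX §5 Thm. 5)

Topic `Literature/Algebra/Lie`, namespace `Literature.Algebra.Lie.LieGoursatTwist`. THEOREMS only (no definition, no named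
fact, no `sorry`). UNCONDITIONAL: the classification of `Aut 𝔰𝔩ₙ` enters through the tree's DISCHARGED fact
`SpecialLinearAutomorphisms.Jacobson1962_sl_automorphisms_holds`.

This is the Lie-algebra half of the tree's `GoursatKolchinRibetLieCore.goursatCore_blockDiagonal` (cell `hodge-nonav`), with
the algebraic-group apparatus (`zariskiClosure`, `identityComponent`, `lieAlgebraGL`, `Ad(Δ)`-equivariance, Schur) REMOVED:
the input is directly a Lie subalgebra `𝔥 ≤ Πⱼ 𝔤𝔩(mⱼ)` (product of matrix algebras with the commutator bracket) all of whose
components are traceless and whose component projections `pⱼ : 𝔥 → 𝔰𝔩(mⱼ)` are SURJECTIVE, and the output is, for a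
chosen factor `i₀`, the dichotomy
* (lift) `Pi.single i₀ Y ∈ 𝔥` for every traceless `Y` — the factor `𝔰𝔩(m_{i₀}) ⊕ 0` lies in `𝔥` —, OR
* (twist) some other factor `j ≠ i₀` is carried onto the `i₀`-th by a fixed conjugation, possibly composed with
  `X ↦ −Xᵀ`: `X_{i₀} = A⁻¹ X_j^e A` for all `X ∈ 𝔥`, or (`|m_{i₀}| > 2`) `X_{i₀} = −A⁻¹ (X_j^e)ᵀ A` for all `X ∈ 𝔥`
  (`e : m_j ≃ m_{i₀}`, `X_j^e = (X_j).submatrix e⁻¹ e⁻¹`, `A` invertible) — i.e. the `i₀`-th standard module of `𝔥` is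
  isomorphic to the `j`-th or to its dual.
Proof: Ribet's lemma `RibetLemma.forall_exists_lift_or_exists_bijective_comp_eq` for the simple `𝔰𝔩(mⱼ)`
(`SpecialLinearSimple.isSimple_sl_of_charZero`); in the second case `p_{i₀} = ψ ∘ p_j` with `ψ : 𝔰𝔩(m_j) ≅ 𝔰𝔩(m_{i₀})`,
`|m_j| = |m_{i₀}|` (`finrank_sl`), and `ψ` re-indexed (`exists_lieHom_sl_reindex`) is an automorphism of `𝔰𝔩(m_{i₀})`,
hence `±Ad(A⁻¹)(ᵀ)` by Jacobson.

USE (cell `pub-hodgeav-hg6`, req-37 (A) Q2b, TABLE X rows 10 / 12 ALL MEMBERS, design note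
`HOME/jobs/A7-inventory-eng5g6/DESIGN-rows10-12-allmembers.md`, brick P1; honest framing of that cell: HC / HC_AV / HC_CM / H2
NOT proved — this file is pure Lie algebra): for `𝔤 = Lie Hg` of an abelian variety with `End⁰ = E` a CM field acting with
`dim_E H¹ = n ∈ {2, 3}`, the derived algebra `[𝔤,𝔤]_ℂ` restricted to the eigenspaces `W_σ` (`σ` in a CM type) is such an `𝔥`
once the per-`σ` projections are onto `𝔰𝔩(W_σ)`; THAT input is supplied, per signature, by: the tree's `(m,1)` complex core
(`HodgeThetaSubalgebraUnitary`, `UnitaryTheta…`) for pairs of signature `(2,1)` / `(1,1)`; «an irreducible linear Lie algebra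
on `ℂ²` contains `𝔰𝔩₂`» for `(2,0)` pairs; and, for a `(3,0)` pair, an `𝔰𝔬₃`-EXCLUSION (ℚ-simplicity of `[𝔤,𝔤]` +
equidimensionality of its complex simple ideals) which is a separate brick (P2′) — NOT implicit here. The twist alternative is
then excluded arithmetically (envelope-centre brick P3).

## References
* [Ribet1976RealMultiplications] K. A. Ribet, Amer. J. Math. 98 (1976), pp. 790–791 (subalgebras of products of simple Lie
  algebras).
* [Katz1990ESDE] N. M. Katz, *Exponential Sums and Differential Equations* (1990), §1.8, proof of Prop. 1.8.2.
* [Jacobson1962LieAlgebras] N. Jacobson, *Lie Algebras* (1962), Ch. IX §5 Theorem 5 (p. 283).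
-/

noncomputable section

namespace Literature.Algebra.Lie.LieGoursatTwist

open Matrix Module LieAlgebra LieAlgebra.SpecialLinear
open Literature.AlgebraicGeometry.HodgeTheory (finrank_sl exists_lieHom_sl_reindex)

variable {k : Type*} [Field k] [IsAlgClosed k] [CharZero k] {ι : Type*} [Fintype ι] [DecidableEq ι]
  {m : ι → Type*} [∀ i, Fintype (m i)] [∀ i, DecidableEq (m i)]

/-- **Lie-level Goursat–Kolchin–Ribet: lift or twist.** Let `k` be algebraically closed of characteristic `0`, `|mⱼ| ≥ 2`,
and `𝔥` a Lie subalgebra of `Πⱼ Matrix (mⱼ) (mⱼ) k` (commutator bracket) whose elements have all components traceless and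
whose component projections onto the `𝔰𝔩(mⱼ)` are surjective. Then for each `i₀`: either `Pi.single i₀ Y ∈ 𝔥` for every
traceless `Y` (the factor `𝔰𝔩(m_{i₀}) ⊕ 0 ≤ 𝔥`), or there are `j ≠ i₀`, a bijection `e : m_j ≃ m_{i₀}` and an invertible `A`
with `X_{i₀} = A⁻¹ · X_j^e · A` for all `X ∈ 𝔥`, or with `|m_{i₀}| > 2` and `X_{i₀} = −A⁻¹ · (X_j^e)ᵀ · A` for all `X ∈ 𝔥`
(`X_j^e = (X j).submatrix e.symm e.symm`). Ribet's lemma + Jacobson's `Aut 𝔰𝔩ₙ` (both tree theorems).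
[cite: Ribet1976RealMultiplications, pp. 790–791] [cite: Katz1990ESDE, §1.8 Prop. 1.8.2 (proof)]
[cite: Jacobson1962LieAlgebras, Ch. IX §5 Theorem 5 (p. 283)] -/
theorem single_mem_or_exists_twist (hm : ∀ i, 2 ≤ Fintype.card (m i)) :
    letI : LieRing (Π j, Matrix (m j) (m j) k) := LieRing.ofAssociativeRing
    letI : LieAlgebra k (Π j, Matrix (m j) (m j) k) := LieAlgebra.ofAssociativeAlgebra
    ∀ (𝔥 : LieSubalgebra k (Π j, Matrix (m j) (m j) k)),
      (∀ X ∈ 𝔥, ∀ j, (X j).trace = 0) →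
      (∀ j, ∀ Y : Matrix (m j) (m j) k, Y.trace = 0 → ∃ X ∈ 𝔥, X j = Y) →
      ∀ i₀ : ι,
        (∀ Y : Matrix (m i₀) (m i₀) k, Y.trace = 0 →
            Pi.single (M := fun j => Matrix (m j) (m j) k) i₀ Y ∈ 𝔥) ∨
          ∃ j, j ≠ i₀ ∧ ∃ e : m j ≃ m i₀, ∃ A : Matrix (m i₀) (m i₀) k, IsUnit A ∧
            ((∀ X ∈ 𝔥, X i₀ = A⁻¹ * (X j).submatrix e.symm e.symm * A) ∨
              (2 < Fintype.card (m i₀) ∧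
                ∀ X ∈ 𝔥, X i₀ = -(A⁻¹ * ((X j).submatrix e.symm e.symm)ᵀ * A))) := by
  letI : LieRing (Π j, Matrix (m j) (m j) k) := LieRing.ofAssociativeRing
  letI : LieAlgebra k (Π j, Matrix (m j) (m j) k) := LieAlgebra.ofAssociativeAlgebra
  intro 𝔥 htr hsurj i₀
  classical
  -- the component projections `p j : 𝔥 → 𝔰𝔩(m j)`, Lie homomorphisms
  let p : ∀ j, 𝔥 →ₗ⁅k⁆ sl (m j) k := fun j =>
    { toFun := fun X => ⟨(X : Π j, Matrix (m j) (m j) k) j, htr X X.2 j⟩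
      map_add' := fun X Y => Subtype.ext rfl
      map_smul' := fun c X => Subtype.ext rfl
      map_lie' := fun {X Y} => Subtype.ext (by
        change ((⁅X, Y⁆ : 𝔥) : Π j, Matrix (m j) (m j) k) j =
          (X : Π j, Matrix (m j) (m j) k) j * (Y : Π j, Matrix (m j) (m j) k) j -
            (Y : Π j, Matrix (m j) (m j) k) j * (X : Π j, Matrix (m j) (m j) k) j
        rw [LieSubalgebra.coe_bracket, Ring.lie_def, Pi.sub_apply, Pi.mul_apply, Pi.mul_apply]) }
  have hp : ∀ j (X : 𝔥), ((p j X : sl (m j) k) : Matrix (m j) (m j) k) = (X : Π j, Matrix (m j) (m j) k) j :=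
    fun _ _ => rfl
  have hpsurj : ∀ j, Function.Surjective (p j) := fun j Y => by
    obtain ⟨X, hX, hXY⟩ := hsurj j Y Y.2
    exact ⟨⟨X, hX⟩, Subtype.ext hXY⟩
  haveI : ∀ j, LieAlgebra.IsSimple k (sl (m j) k) := fun j =>
    Literature.Algebra.Lie.SpecialLinearSimple.isSimple_sl_of_charZero (m j) k (hm j)
  -- Ribet's dichotomy at `i₀`
  rcases Literature.Algebra.Lie.RibetLemma.forall_exists_lift_or_exists_bijective_comp_eq p Finset.univ
      (fun j _ => hpsurj j) (Finset.mem_univ i₀) with hlift | ⟨j, -, hji, ψ, hψ, hcomp⟩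
  · -- Case A: every traceless `Y` lifts to an element supported at `i₀`, which is `Pi.single i₀ Y`
    left
    intro Y hY
    obtain ⟨x, hxa, hx0⟩ := hlift ⟨Y, hY⟩
    have hx : (x : Π j, Matrix (m j) (m j) k) = Pi.single (M := fun j => Matrix (m j) (m j) k) i₀ Y := by
      funext j
      by_cases hj : j = i₀
      · subst hj
        rw [Pi.single_eq_same]
        exact congrArg Subtype.val hxa
      · rw [Pi.single_eq_of_ne hj]
        exact congrArg Subtype.val (hx0 j (Finset.mem_univ j) hj)
    exact hx ▸ x.2
  · -- Case B: `p i₀ = ψ ∘ p j` with `ψ : 𝔰𝔩(m j) ≅ 𝔰𝔩(m i₀)`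
    right
    haveI : Nonempty (m j) := Fintype.card_pos_iff.1 (by linarith [hm j])
    haveI : Nonempty (m i₀) := Fintype.card_pos_iff.1 (by linarith [hm i₀])
    -- `|m j| = |m i₀|`
    have hcard : Fintype.card (m j) = Fintype.card (m i₀) := by
      have h := LinearEquiv.finrank_eq (LinearEquiv.ofBijective (ψ : sl (m j) k →ₗ[k] sl (m i₀) k) hψ)
      rw [finrank_sl, finrank_sl] at h
      have ha : 1 ≤ Fintype.card (m j) ^ 2 := Nat.one_le_pow _ _ (by linarith [hm j])
      have hb : 1 ≤ Fintype.card (m i₀) ^ 2 := Nat.one_le_pow _ _ (by linarith [hm i₀])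
      exact Nat.pow_left_injective two_ne_zero
        (by simpa using (show Fintype.card (m j) ^ 2 = Fintype.card (m i₀) ^ 2 by omega))
    obtain ⟨e⟩ : Nonempty (m j ≃ m i₀) := ⟨Fintype.equivOfCardEq hcard⟩
    -- re-index: `ρ : 𝔰𝔩(m i₀) → 𝔰𝔩(m j)`, `ρ Z = Z.submatrix e e`, and the automorphism `φ = ψ ∘ ρ` of `𝔰𝔩(m i₀)`
    obtain ⟨ρ, hρbij, hρ⟩ := exists_lieHom_sl_reindex (k := k) e
    let φ : sl (m i₀) k ≃ₗ⁅k⁆ sl (m i₀) k := LieEquiv.ofBijective (ψ.comp ρ) (hψ.comp hρbij)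
    have hφ : ∀ Z, φ Z = ψ (ρ Z) := fun Z => rfl
    have hψp : ∀ x : 𝔥, ψ (p j x) = p i₀ x := fun x => LieHom.congr_fun hcomp x
    -- for `X ∈ 𝔥`: `X i₀ = φ (X_j^e)`
    have hmem : ∀ X ∈ 𝔥, ((X j).submatrix e.symm e.symm).trace = 0 := fun X hX => by
      rw [Literature.AlgebraicGeometry.HodgeTheory.trace_submatrix_equiv]
      exact htr X hX j
    have hkey : ∀ X (hX : X ∈ 𝔥), X i₀ = ((φ ⟨(X j).submatrix e.symm e.symm, hmem X hX⟩ : sl (m i₀) k) :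
        Matrix (m i₀) (m i₀) k) := by
      intro X hX
      have hρZ : ρ ⟨(X j).submatrix e.symm e.symm, hmem X hX⟩ = p j ⟨X, hX⟩ := by
        apply Subtype.ext
        rw [hρ, hp]
        change ((X j).submatrix e.symm e.symm).submatrix e e = X j
        rw [submatrix_submatrix, Equiv.symm_comp_self, submatrix_id_id]
      rw [hφ, hρZ, hψp, hp]
    -- Jacobson: `φ = Ad(A⁻¹)` or `−Ad(A⁻¹) ∘ ᵀ`
    obtain ⟨A, hA, hform⟩ :=
      Literature.Algebra.Lie.SpecialLinearAutomorphisms.Jacobson1962_sl_automorphisms_holds k (m i₀) (hm i₀) φ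
    refine ⟨j, hji, e, A, hA, ?_⟩
    rcases hform with hplus | ⟨h3, hminus⟩
    · exact Or.inl fun X hX => by rw [hkey X hX, hplus]
    · exact Or.inr ⟨h3, fun X hX => by rw [hkey X hX, hminus]⟩


/-! ### §2 The same for a family of Lie homomorphisms into matrix algebras (the form consumed by restriction maps) -/

/-- **Lift or twist, homomorphism form.** Let `L` be a Lie algebra over the algebraically closed field `k` of characteristic `0`
and `ρ j : L → Matrix (m j) (m j) k` (`|m j| ≥ 2`) Lie homomorphisms for the commutator bracket, each with traceless values and
each mapping ONTO the traceless matrices.  Then for each `i₀`: either every traceless `Y` is `ρ i₀ x` for some `x ∈ L` killed by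
all the other `ρ j` (the `i₀`-th factor `𝔰𝔩 ⊕ 0` lies in the joint image), or some `j ≠ i₀` is twisted onto `i₀`:
`ρ i₀ x = A⁻¹ · (ρ j x)^e · A` for all `x`, or (`|m i₀| > 2`) `ρ i₀ x = −A⁻¹ · ((ρ j x)^e)ᵀ · A` for all `x`.  (§1 applied to the joint
image `x ↦ (ρ j x)ⱼ`, a Lie subalgebra of `Πⱼ Matrix (m j) (m j) k`.)  In the Hodge application `L` is the complexified derived
algebra of `Lie Hg` and `ρ σ X` the matrix of `X|_{W_σ}` in a basis of the eigenspace `W_σ`.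
[cite: Ribet1976RealMultiplications, pp. 790–791] [cite: Katz1990ESDE, §1.8 Prop. 1.8.2 (proof)]
[cite: Jacobson1962LieAlgebras, Ch. IX §5 Theorem 5 (p. 283)] -/
theorem exists_eq_single_or_exists_twist_of_lieHom (hm : ∀ i, 2 ≤ Fintype.card (m i)) {L : Type*} [LieRing L]
    [LieAlgebra k L] :
    letI : ∀ j, LieRing (Matrix (m j) (m j) k) := fun _ => LieRing.ofAssociativeRing
    letI : ∀ j, LieAlgebra k (Matrix (m j) (m j) k) := fun _ => LieAlgebra.ofAssociativeAlgebra
    ∀ (ρ : ∀ j, L →ₗ⁅k⁆ Matrix (m j) (m j) k),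
      (∀ x j, (ρ j x).trace = 0) →
      (∀ j, ∀ Y : Matrix (m j) (m j) k, Y.trace = 0 → ∃ x, ρ j x = Y) →
      ∀ i₀ : ι,
        (∀ Y : Matrix (m i₀) (m i₀) k, Y.trace = 0 → ∃ x, ρ i₀ x = Y ∧ ∀ j, j ≠ i₀ → ρ j x = 0) ∨
          ∃ j, j ≠ i₀ ∧ ∃ e : m j ≃ m i₀, ∃ A : Matrix (m i₀) (m i₀) k, IsUnit A ∧
            ((∀ x, ρ i₀ x = A⁻¹ * (ρ j x).submatrix e.symm e.symm * A) ∨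
              (2 < Fintype.card (m i₀) ∧ ∀ x, ρ i₀ x = -(A⁻¹ * ((ρ j x).submatrix e.symm e.symm)ᵀ * A))) := by
  letI : ∀ j, LieRing (Matrix (m j) (m j) k) := fun _ => LieRing.ofAssociativeRing
  letI : ∀ j, LieAlgebra k (Matrix (m j) (m j) k) := fun _ => LieAlgebra.ofAssociativeAlgebra
  letI iP : LieRing (Π j, Matrix (m j) (m j) k) := LieRing.ofAssociativeRing
  letI iPA : LieAlgebra k (Π j, Matrix (m j) (m j) k) := LieAlgebra.ofAssociativeAlgebra
  intro ρ htr hsurj i₀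
  classical
  -- the joint homomorphism `x ↦ (ρ j x)ⱼ` into the product and its range `𝔥`
  let P : L →ₗ⁅k⁆ (Π j, Matrix (m j) (m j) k) :=
    { toFun := fun x j => ρ j x
      map_add' := fun x y => funext fun j => by rw [Pi.add_apply, map_add]
      map_smul' := fun c x => funext fun j => by rw [Pi.smul_apply, map_smul, RingHom.id_apply]
      map_lie' := fun {x y} => funext fun j => by
        rw [Ring.lie_def, Pi.sub_apply, Pi.mul_apply, Pi.mul_apply]
        change ρ j ⁅x, y⁆ = ρ j x * ρ j y - ρ j y * ρ j x
        rw [LieHom.map_lie, Ring.lie_def] }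
  have hP : ∀ x j, P x j = ρ j x := fun _ _ => rfl
  set 𝔥 : LieSubalgebra k (Π j, Matrix (m j) (m j) k) := P.range with h𝔥
  have hmem : ∀ X, X ∈ 𝔥 ↔ ∃ x, P x = X := fun X => LieHom.mem_range P X
  have htr' : ∀ X ∈ 𝔥, ∀ j, (X j).trace = 0 := by
    intro X hX j
    obtain ⟨x, rfl⟩ := (hmem X).1 hX
    exact htr x j
  have hsurj' : ∀ j, ∀ Y : Matrix (m j) (m j) k, Y.trace = 0 → ∃ X ∈ 𝔥, X j = Y := by
    intro j Y hY
    obtain ⟨x, hx⟩ := hsurj j Y hY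
    exact ⟨P x, (hmem _).2 ⟨x, rfl⟩, hx⟩
  rcases single_mem_or_exists_twist (k := k) hm 𝔥 htr' hsurj' i₀ with hlift | ⟨j, hji, e, A, hA, htw⟩
  · left
    intro Y hY
    obtain ⟨x, hx⟩ := (hmem _).1 (hlift Y hY)
    refine ⟨x, ?_, fun j hj => ?_⟩
    · rw [← hP, hx, Pi.single_eq_same]
    · rw [← hP, hx, Pi.single_eq_of_ne hj]
  · right
    refine ⟨j, hji, e, A, hA, ?_⟩
    rcases htw with hplus | ⟨h3, hminus⟩
    · exact Or.inl fun x => by rw [← hP, ← hP, hplus (P x) ((hmem _).2 ⟨x, rfl⟩)]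
    · exact Or.inr ⟨h3, fun x => by rw [← hP, ← hP, hminus (P x) ((hmem _).2 ⟨x, rfl⟩)]⟩


/-! ### §3 The same for a bracket-closed space of endomorphisms preserving a family of subspaces with bases -/

/-- **Lift or twist for a family of invariant subspaces.** `k` algebraically closed of characteristic `0`; `W i ⊆ M`
(`i ∈ ι`) subspaces with bases `b i` of size `d ≥ 2`; `𝔇 ⊆ End_k(M)` a bracket-closed subspace preserving every `W i`, with
TRACELESS restrictions, such that every traceless endomorphism of each `W i` is the restriction of an element of `𝔇`. Then for
each `i₀`: either every traceless `Z ∈ End(W i₀)` is the restriction of an `X ∈ 𝔇` VANISHING on the other `W j` (LIFT), or for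
some `j ≠ i₀`, a bijection `e` of `Fin d` and an invertible matrix `A`, the matrices of the restrictions satisfy
`[X|_{W i₀}] = A⁻¹ · [X|_{W j}]^e · A` for all `X ∈ 𝔇`, or (`d > 2`) `[X|_{W i₀}] = −A⁻¹ · ([X|_{W j}]^e)ᵀ · A` for all
`X ∈ 𝔇` (TWIST) — §2 for the Lie homomorphisms `X ↦ [X|_{W i}]` (matrices in the bases `b i`). In the Hodge application
`M = V_ℂ`, `W i` the eigenspaces of a CM type, `𝔇` the complexified derived algebra of `Lie Hg`; LIFT is the hypothesis of the
cell's `CMThetaSocket.mem_spanC_of_lift_of_centre`. [cite: Katz1990ESDE, §1.8 Prop. 1.8.2 (proof)]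
[cite: Ribet1976RealMultiplications, pp. 790–791] [cite: Jacobson1962LieAlgebras, Ch. IX §5 Theorem 5 (p. 283)] -/
theorem lift_or_twist_of_submodules {M : Type*} [AddCommGroup M] [Module k M] (W : ι → Submodule k M) {d : ℕ}
    (hd : 2 ≤ d) (b : ∀ i, Module.Basis (Fin d) k ↥(W i)) (𝔇 : Submodule k (Module.End k M))
    (hbr : ∀ X ∈ 𝔇, ∀ Y ∈ 𝔇, X * Y - Y * X ∈ 𝔇) (hW : ∀ X ∈ 𝔇, ∀ i, ∀ w ∈ W i, X w ∈ W i)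
    (htr : ∀ X (hX : X ∈ 𝔇) i, LinearMap.trace k _ (X.restrict (hW X hX i)) = 0)
    (hproj : ∀ i, ∀ Z : Module.End k ↥(W i), LinearMap.trace k _ Z = 0 → ∃ X ∈ 𝔇, ∀ w : ↥(W i), X w = Z w) (i₀ : ι) :
    (∀ Z : Module.End k ↥(W i₀), LinearMap.trace k _ Z = 0 →
        ∃ X ∈ 𝔇, (∀ w : ↥(W i₀), X w = Z w) ∧ ∀ j, j ≠ i₀ → ∀ w ∈ W j, X w = 0) ∨
      ∃ j, j ≠ i₀ ∧ ∃ e : Fin d ≃ Fin d, ∃ A : Matrix (Fin d) (Fin d) k, IsUnit A ∧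
        ((∀ X (hX : X ∈ 𝔇), LinearMap.toMatrix (b i₀) (b i₀) (X.restrict (hW X hX i₀)) =
            A⁻¹ * (LinearMap.toMatrix (b j) (b j) (X.restrict (hW X hX j))).submatrix e.symm e.symm * A) ∨
          (2 < d ∧ ∀ X (hX : X ∈ 𝔇), LinearMap.toMatrix (b i₀) (b i₀) (X.restrict (hW X hX i₀)) =
            -(A⁻¹ * ((LinearMap.toMatrix (b j) (b j) (X.restrict (hW X hX j))).submatrix e.symm e.symm)ᵀ * A))) := by
  classical
  letI iM : LieRing (Module.End k M) := LieRing.ofAssociativeRing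
  letI iMA : LieAlgebra k (Module.End k M) := LieAlgebra.ofAssociativeAlgebra
  letI iF : LieRing (Matrix (Fin d) (Fin d) k) := LieRing.ofAssociativeRing
  letI iFA : LieAlgebra k (Matrix (Fin d) (Fin d) k) := LieAlgebra.ofAssociativeAlgebra
  -- `𝔇` as a Lie subalgebra `L` of `𝔤𝔩(M)`
  let L : LieSubalgebra k (Module.End k M) :=
    { 𝔇 with
      lie_mem' := fun {X Y} hX hY => by
        rw [Ring.lie_def]
        exact hbr X hX Y hY }
  have hmemL : ∀ X, X ∈ L ↔ X ∈ 𝔇 := fun X => Iff.rfl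
  -- the restriction homomorphisms `ρ i : L → Matrix`, `X ↦ [X|_{W i}]`
  have hres_mul : ∀ (X Y : Module.End k M) (hX : X ∈ 𝔇) (hY : Y ∈ 𝔇) (hXY : X * Y ∈ 𝔇) i,
      (X * Y).restrict (hW _ hXY i) = X.restrict (hW X hX i) * Y.restrict (hW Y hY i) :=
    fun X Y hX hY hXY i => LinearMap.ext fun w => Subtype.ext rfl
  let ρ : ∀ i : ι, L →ₗ⁅k⁆ Matrix (Fin d) (Fin d) k := fun i =>
    { toFun := fun X => LinearMap.toMatrix (b i) (b i) ((X : Module.End k M).restrict (hW X X.2 i))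
      map_add' := fun X Y => by
        rw [← map_add]
        exact congrArg _ (LinearMap.ext fun w => Subtype.ext rfl)
      map_smul' := fun c X => by
        rw [RingHom.id_apply, ← map_smul]
        exact congrArg _ (LinearMap.ext fun w => Subtype.ext rfl)
      map_lie' := fun {X Y} => by
        rw [Ring.lie_def, ← LinearMap.toMatrix_mul, ← LinearMap.toMatrix_mul, ← map_sub]
        exact congrArg _ (LinearMap.ext fun w => Subtype.ext rfl) }
  have hρ : ∀ i (X : L), ρ i X = LinearMap.toMatrix (b i) (b i) ((X : Module.End k M).restrict (hW X X.2 i)) :=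
    fun _ _ => rfl
  have htr' : ∀ (X : L) i, (ρ i X).trace = 0 := fun X i => by
    rw [hρ, ← LinearMap.trace_eq_matrix_trace k (b i)]
    exact htr X X.2 i
  have hsurj' : ∀ i, ∀ Y : Matrix (Fin d) (Fin d) k, Y.trace = 0 → ∃ X : L, ρ i X = Y := by
    intro i Y hY
    have hZ : LinearMap.trace k _ (Matrix.toLin (b i) (b i) Y) = 0 := by
      rw [LinearMap.trace_eq_matrix_trace k (b i), LinearMap.toMatrix_toLin]; exact hY
    obtain ⟨X, hX, hXZ⟩ := hproj i _ hZ
    refine ⟨⟨X, hX⟩, ?_⟩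
    rw [hρ]
    have h : X.restrict (hW X hX i) = Matrix.toLin (b i) (b i) Y := LinearMap.ext fun w => Subtype.ext (hXZ w)
    change LinearMap.toMatrix (b i) (b i) (X.restrict (hW X hX i)) = Y
    rw [h, LinearMap.toMatrix_toLin]
  rcases exists_eq_single_or_exists_twist_of_lieHom (k := k) (m := fun _ : ι => Fin d) (fun _ => by simpa using hd) ρ
      htr' hsurj' i₀ with hlift | ⟨j, hji, e, A, hA, htw⟩
  · left
    intro Z hZ
    obtain ⟨x, hx, hx0⟩ := hlift (LinearMap.toMatrix (b i₀) (b i₀) Z) (by rw [← LinearMap.trace_eq_matrix_trace]; exact hZ)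
    have hres : (x : Module.End k M).restrict (hW x x.2 i₀) = Z := (LinearMap.toMatrix (b i₀) (b i₀)).injective hx
    refine ⟨x, x.2, fun w => ?_, fun j hj w hw => ?_⟩
    · have h := LinearMap.congr_fun hres w
      exact congrArg Subtype.val h
    · have h0 : (x : Module.End k M).restrict (hW x x.2 j) = 0 :=
        (LinearMap.toMatrix (b j) (b j)).injective (by rw [map_zero]; exact hx0 j hj)
      have h := LinearMap.congr_fun h0 ⟨w, hw⟩
      exact congrArg Subtype.val h
  · right
    refine ⟨j, hji, e, A, hA, ?_⟩
    rcases htw with hplus | ⟨h3, hminus⟩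
    · exact Or.inl fun X hX => hplus ⟨X, hX⟩
    · exact Or.inr ⟨by simpa using h3, fun X hX => hminus ⟨X, hX⟩⟩

end Literature.Algebra.Lie.LieGoursatTwist

end
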